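import Summits.KontsevichZagierPeriods.KontsevichZagierPeriods.Theorems.LinRedNormalFormArrangementNormalFormSeparateHighCarry
import Summits.KontsevichZagierPeriods.KontsevichZagierPeriods.Theorems.LinRedNormalFormArrangementNormalFormSeparateHighCandidates
import Summits.KontsevichZagierPeriods.KontsevichZagierPeriods.Theorems.LinRedNormalFormArrangementNormalFormSeparateDirection

/-!
# The fan interface of `stub_separateHigh`: pieces with good rational directions

(Line `janus-bands`, crux `ArrangementNormalForm`, stub `stub_separateHigh` — separation in base
dimension `≥ 3`; part `Fan`, valid in every base dimension `B + 2 ≥ 2`.)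

What the open FAN LEMMA of `stub_separateHigh` has to deliver, and what it buys. A FAN
CERTIFICATE for a formal combination `x` (typically `x = [s]`, `s` literal `JJ (B+2) k` data with
letters `L, e`, numerator `p`, fibre data `a, lo, hi`) is a congruence of `x` modulo
`KZ.relations` to a `ℤ`-combination of literal Janus band pieces `s₁` (own base rows `M₁`, the
same integrand data) each equipped with a rational direction `v` (`v_{last} ≠ 0`) such that the
letters with `∂ᵥL_j = ∑ᵢ (L j).1 i vᵢ ≠ 0`, `e_j ≠ 0` do not vanish on the piece and satisfy the
RATIO condition `|L_{j'}| ≤ C |∂ᵥL_j · L_{j'} − ∂ᵥL_{j'} · L_j|` for non-proportional pairs.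
* `separateHigh_of_fan_carry` (registered part): a fan certificate puts `x` into the closure of
  the intermediate class `GG♮ (B+1) k` (one `ỹ`-pole, arbitrary numerator) — base change along
  `v` (`SepHigh.dirAinv`) and `separatePos_direction`; NO hypothesis on the numerator;
* `separateHigh_of_fan` (registered part): if moreover the numerator is bounded away from zero on
  every piece, `x` lands in `closure (GG (B+1) 1 k)` (`separateHigh_direction`).
`separateHigh_of_flatsDisjoint` constructs such a certificate when no codimension-2 flat of two
active letters meets the closed base cell; the general case (flats touching the closed cell:
local conical refinement at the touching faces) is the open fan lemma, and `GG♮ → GG` for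
numerators vanishing on the closed cell is the open numerator split (`separatePos_split`, `hI`).
-/

noncomputable section

open Set MeasureTheory MvPolynomial

namespace Summit.KontsevichZagierPeriods.ArrangementNormalForm.JanusBands

open Literature.NumberTheory.Transcendental

open SeparatePos SepHigh in
/-- **Fan certificate ⟹ intermediate class `GG♮`** (registered part of `stub_separateHigh`; every
base dimension `B + 2 ≥ 2`, any numerator): see the module docstring.
[Kontsevich–Zagier 2001, §1.2] -/
theorem separateHigh_of_fan_carry (B k m : ℕ) (L : Fin m → (Fin (B + 2) → ℚ) × ℚ) (e : Fin m → ℕ) (p : MvPolynomial (Fin (B + 2)) ℚ) (a : Fin k → Option ((Fin (B + 2) → ℚ) × ℚ)) (lo hi : Fin k → Fin k ⊕ ((Fin (B + 2) → ℚ) × ℚ)) (x : KZ.FormalRep) (hfan : ∃ c ∈ AddSubgroup.closure {w : KZ.FormalRep | ∃ (m₁ : ℕ) (M₁ : Fin m₁ → (Fin (B + 2) → ℚ) × ℚ) (s₁ : KZ.IntegralRep (B + 2 + k)) (v : Fin (B + 2) → ℚ), v (Fin.last (B + 1)) ≠ 0 ∧ Bornology.IsBounded s₁.domain ∧ s₁.domain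 = {z | (∀ j, 0 < ∑ i, ((M₁ j).1 i : ℝ) * z (Fin.castAdd k i) + ((M₁ j).2 : ℝ)) ∧ ∀ i, Sum.elim (fun j => z (Fin.natAdd (B + 2) j)) (fun c => ∑ i', (c.1 i' : ℝ) * z (Fin.castAdd k i') + (c.2 : ℝ)) (lo i) < z (Fin.natAdd (B + 2) i) ∧ z (Fin.natAdd (B + 2) i) < Sum.elim (fun j => z (Fin.natAdd (B + 2) j)) (fun c => ∑ i', (c.1 i' : ℝ) * z (Fin.castAdd k i') + (c.2 : ℝ)) (hi i)} ∧ EqOn s₁.integrand (fun z => MvPolynomial.aeval (fun i => z (Fin.castAdd k i)) p / (∏ j, (∑ i, ((L j).1 i : ℝ) * z (Fin.castAdd k i) + ((L j).2 : ℝ)) ^ e j) * ∏ i, (a i).elim 1 (fun c => 1 / (z (Fin.natAdd (B + 2) i) - (∑ i', (c.1 i' : ℝ) * z (Fin.castAdd k i') + (c.2 : ℝ))))) s₁.domain ∧ (∀ j, (∑ i, (L j).1 i * v i) ≠ 0 → e j ≠ 0 → ∀ z ∈ s₁.domain, ∑ i, ((L j).1 i : ℝ) * z (Fin.castAdd k i)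 + ((L j).2 : ℝ) ≠ 0) ∧ (∀ j j', (∑ i, (L j).1 i * v i) ≠ 0 → (∑ i, (L j').1 i * v i) ≠ 0 → e j ≠ 0 → e j' ≠ 0 → (∑ i, (L j').1 i * v i) • L j ≠ (∑ i, (L j).1 i * v i) • L j' → ∃ C : ℝ, ∀ z ∈ s₁.domain, |∑ i, ((L j').1 i : ℝ) * z (Fin.castAdd k i) + ((L j').2 : ℝ)| ≤ C * |(((∑ i, (L j).1 i * v i) : ℚ) : ℝ) * (∑ i, ((L j').1 i : ℝ) * z (Fin.castAdd k i) + ((L j').2 : ℝ)) - (((∑ i, (L j').1 i * v i) : ℚ) : ℝ) * (∑ i, ((L j).1 i : ℝ) * z (Fin.castAdd k i) + ((L j).2 : ℝ))|) ∧ w = KZ.of s₁}, x - c ∈ KZ.relations) : ∃ c ∈ AddSubgroup.closure {w : KZ.FormalRep | ∃ (m m' n : ℕ) (s : KZ.IntegralRep (B + 1 + 1 + k)) (M : Fin m' → (Fin (B + 1 + 1) → ℚ) × ℚ) (L : Fin m → (Fin (B + 1) → ℚ) × ℚ) (e : Fin m → ℕ) (p : MvPolynomial (Fin (B + 1 + 1))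 ℚ) (ℓ : (Fin (B + 1) → ℚ) × ℚ) (a : Fin k → Option ((Fin (B + 1 + 1) → ℚ) × ℚ)) (lo hi : Fin k → Fin k ⊕ ((Fin (B + 1 + 1) → ℚ) × ℚ)), (n ≠ 0 → ∀ z ∈ s.domain, z (Fin.castAdd k (Fin.last (B + 1))) - (∑ i, (ℓ.1 i : ℝ) * z (Fin.castAdd k (Fin.castSucc i)) + (ℓ.2 : ℝ)) ≠ 0) ∧ Bornology.IsBounded s.domain ∧ s.domain = {z | (∀ j, 0 < ∑ i, ((M j).1 i : ℝ) * z (Fin.castAdd k i) + ((M j).2 : ℝ)) ∧ ∀ i, Sum.elim (fun j => z (Fin.natAdd (B + 1 + 1) j)) (fun c => ∑ i', (c.1 i' : ℝ) * z (Fin.castAdd k i') + (c.2 : ℝ)) (lo i) < z (Fin.natAdd (B + 1 + 1) i) ∧ z (Fin.natAdd (B + 1 + 1) i) < Sum.elim (fun j => z (Fin.natAdd (B + 1 + 1) j)) (fun c => ∑ i', (c.1 i' : ℝ) * z (Fin.castAdd k i') + (c.2 : ℝ)) (hi i)} ∧ EqOn s.integrand (fun z => MvPolynomial.aeval (fun i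 => z (Fin.castAdd k i)) p / (∏ j, (∑ i, ((L j).1 i : ℝ) * z (Fin.castAdd k (Fin.castSucc i)) + ((L j).2 : ℝ)) ^ e j) * (1 / (z (Fin.castAdd k (Fin.last (B + 1))) - (∑ i, (ℓ.1 i : ℝ) * z (Fin.castAdd k (Fin.castSucc i)) + (ℓ.2 : ℝ))) ^ n) * ∏ i, (a i).elim 1 (fun c => 1 / (z (Fin.natAdd (B + 1 + 1) i) - (∑ i', (c.1 i' : ℝ) * z (Fin.castAdd k i') + (c.2 : ℝ))))) s.domain ∧ w = KZ.of s}, x - c ∈ KZ.relations := by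
  obtain ⟨c, hc, hxc⟩ := hfan
  -- it suffices to treat one piece
  suffices hpiece : ∀ w ∈ {w : KZ.FormalRep | ∃ (m₁ : ℕ) (M₁ : Fin m₁ → (Fin (B + 2) → ℚ) × ℚ)
      (s₁ : KZ.IntegralRep (B + 2 + k)) (v : Fin (B + 2) → ℚ), v (Fin.last (B + 1)) ≠ 0 ∧
      Bornology.IsBounded s₁.domain ∧
      s₁.domain = {z | (∀ j, 0 < ∑ i, ((M₁ j).1 i : ℝ) * z (Fin.castAdd k i) + ((M₁ j).2 : ℝ)) ∧
        ∀ i, Sum.elim (fun j => z (Fin.natAdd (B + 2) j)) (fun c => ∑ i', (c.1 i' : ℝ) *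
          z (Fin.castAdd k i') + (c.2 : ℝ)) (lo i) < z (Fin.natAdd (B + 2) i) ∧
          z (Fin.natAdd (B + 2) i) < Sum.elim (fun j => z (Fin.natAdd (B + 2) j))
          (fun c => ∑ i', (c.1 i' : ℝ) * z (Fin.castAdd k i') + (c.2 : ℝ)) (hi i)} ∧
      EqOn s₁.integrand (fun z => MvPolynomial.aeval (fun i => z (Fin.castAdd k i)) p /
        (∏ j, (∑ i, ((L j).1 i : ℝ) * z (Fin.castAdd k i) + ((L j).2 : ℝ)) ^ e j) *
        ∏ i, (a i).elim 1 (fun c => 1 / (z (Fin.natAdd (B + 2) i) -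
          (∑ i', (c.1 i' : ℝ) * z (Fin.castAdd k i') + (c.2 : ℝ))))) s₁.domain ∧
      (∀ j, (∑ i, (L j).1 i * v i) ≠ 0 → e j ≠ 0 → ∀ z ∈ s₁.domain,
        ∑ i, ((L j).1 i : ℝ) * z (Fin.castAdd k i) + ((L j).2 : ℝ) ≠ 0) ∧
      (∀ j j', (∑ i, (L j).1 i * v i) ≠ 0 → (∑ i, (L j').1 i * v i) ≠ 0 → e j ≠ 0 → e j' ≠ 0 →
        (∑ i, (L j').1 i * v i) • L j ≠ (∑ i, (L j).1 i * v i) • L j' →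
        ∃ C : ℝ, ∀ z ∈ s₁.domain, |∑ i, ((L j').1 i : ℝ) * z (Fin.castAdd k i) + ((L j').2 : ℝ)| ≤
          C * |(((∑ i, (L j).1 i * v i) : ℚ) : ℝ) * (∑ i, ((L j').1 i : ℝ) * z (Fin.castAdd k i) +
            ((L j').2 : ℝ)) - (((∑ i, (L j').1 i * v i) : ℚ) : ℝ) *
            (∑ i, ((L j).1 i : ℝ) * z (Fin.castAdd k i) + ((L j).2 : ℝ))|) ∧
      w = KZ.of s₁}, ∃ c' ∈ AddSubgroup.closure (GNset (B + 1) k), w - c' ∈ KZ.relations by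
    obtain ⟨c', hc', hcc⟩ := SepTwoZero.closure_transfer' hpiece c hc
    refine ⟨c', hc', ?_⟩
    have := add_mem hxc hcc
    rwa [sub_add_sub_cancel] at this
  rintro w ⟨m₁, M₁, s₁, v, hv, hbd₁, hdom₁, hint₁, hpole, hrat, rfl⟩
  obtain ⟨hA', hA⟩ := dirAinv_mul_inv (n := B + 1) v hv
  refine separatePos_direction B k m m₁ s₁ M₁ L e p a lo hi hbd₁ hdom₁ hint₁ (dirAinv v)⁻¹
    (dirAinv v) hA hA' (fun j hα he z hz => ?_) (fun j j' hα hα' he he' hne => ?_)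
  · rw [vecMul_dirAinv_last] at hα
    exact hpole j hα he z hz
  · rw [vecMul_dirAinv_last] at hα hne
    rw [vecMul_dirAinv_last] at hα' hne
    rw [vecMul_dirAinv_last, vecMul_dirAinv_last]
    exact hrat j j' hα hα' he he' hne

open SeparatePos SepHigh in
/-- **Fan certificate with numerators bounded away from zero ⟹ separated** (registered part of
`stub_separateHigh`; every base dimension `B + 2 ≥ 2`): see the module docstring.
[Kontsevich–Zagier 2001, §1.2] -/
theorem separateHigh_of_fan (GG : ℕ → ℕ → ℕ → Set KZ.FormalRep) (hGG : ∀ b σ k, GG b σ k = {w : KZ.FormalRep | ∃ (m m' n₁ n₂ : ℕ) (s : KZ.IntegralRep (b + 1 + k)) (M : Fin m' → (Fin (b + 1) → ℚ) × ℚ) (L : Fin m → (Fin b → ℚ) × ℚ) (e : Fin m → ℕ) (p : MvPolynomial (Fin b) ℚ) (ℓ₁ ℓ₂ : (Fin b → ℚ) × ℚ) (a : Fin k → Option ((Fin (b + 1) → ℚ) × ℚ)) (lo hi : Fin k → Fin k ⊕ ((Fin (b + 1) → ℚ) × ℚ)), (n₁ = 0 ∨ n₂ = 0) ∧ (σ =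 2 → (∀ i c, a i = some c → c.1 (Fin.last b) = 0) ∧ (∀ i c, (lo i = Sum.inr c ∨ hi i = Sum.inr c) → (c.1 (Fin.last b) = 0 ∨ c = (Pi.single (Fin.last b) 1, 0)))) ∧ Bornology.IsBounded s.domain ∧ s.domain = {z | (∀ j, 0 < ∑ i, ((M j).1 i : ℝ) * z (Fin.castAdd k i) + ((M j).2 : ℝ)) ∧ ∀ i, Sum.elim (fun j => z (Fin.natAdd (b + 1) j)) (fun c => ∑ i', (c.1 i' : ℝ) * z (Fin.castAdd k i') + (c.2 : ℝ)) (lo i) < z (Fin.natAdd (b + 1) i) ∧ z (Fin.natAdd (b + 1) i) < Sum.elim (fun j => z (Fin.natAdd (b + 1) j)) (fun c => ∑ i', (c.1 i' : ℝ) * z (Fin.castAdd k i') + (c.2 : ℝ)) (hi i)} ∧ EqOn s.integrand (fun z => MvPolynomial.aeval (fun i => z (Fin.castAdd k (Fin.castSucc i))) p / (∏ j, (∑ i, ((L j).1 i : ℝ) * z (Fin.castAdd k (Fin.castSucc i)) + ((L j).2 : ℝ)) ^ e j) * ((z (Fin.castAdd k (Fin.last b)) - (∑ i, (ℓ₁.1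 i : ℝ) * z (Fin.castAdd k (Fin.castSucc i)) + (ℓ₁.2 : ℝ))) ^ n₁ / (z (Fin.castAdd k (Fin.last b)) - (∑ i, (ℓ₂.1 i : ℝ) * z (Fin.castAdd k (Fin.castSucc i)) + (ℓ₂.2 : ℝ))) ^ n₂) * ∏ i, (a i).elim 1 (fun c => 1 / (z (Fin.natAdd (b + 1) i) - (∑ i', (c.1 i' : ℝ) * z (Fin.castAdd k i') + (c.2 : ℝ))))) s.domain ∧ w = KZ.of s}) (B k m : ℕ) (L : Fin m → (Fin (B + 2) → ℚ) × ℚ) (e : Fin m → ℕ) (p : MvPolynomial (Fin (B + 2)) ℚ) (a : Fin k → Option ((Fin (B + 2) → ℚ) × ℚ)) (lo hi : Fin k → Fin k ⊕ ((Fin (B + 2) → ℚ) × ℚ)) (x : KZ.FormalRep) (hfan : ∃ c ∈ AddSubgroup.closure {w : KZ.FormalRep | ∃ (m₁ : ℕ) (M₁ : Fin m₁ → (Fin (B + 2) → ℚ) × ℚ) (s₁ : KZ.IntegralRep (B + 2 + k)) (v : Fin (B + 2) → ℚ), v (Fin.last (B + 1)) ≠ 0 ∧ Bornology.IsBounded s₁.domain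 ∧ s₁.domain = {z | (∀ j, 0 < ∑ i, ((M₁ j).1 i : ℝ) * z (Fin.castAdd k i) + ((M₁ j).2 : ℝ)) ∧ ∀ i, Sum.elim (fun j => z (Fin.natAdd (B + 2) j)) (fun c => ∑ i', (c.1 i' : ℝ) * z (Fin.castAdd k i') + (c.2 : ℝ)) (lo i) < z (Fin.natAdd (B + 2) i) ∧ z (Fin.natAdd (B + 2) i) < Sum.elim (fun j => z (Fin.natAdd (B + 2) j)) (fun c => ∑ i', (c.1 i' : ℝ) * z (Fin.castAdd k i') + (c.2 : ℝ)) (hi i)} ∧ EqOn s₁.integrand (fun z => MvPolynomial.aeval (fun i => z (Fin.castAdd k i)) p / (∏ j, (∑ i, ((L j).1 i : ℝ) * z (Fin.castAdd k i) + ((L j).2 : ℝ)) ^ e j) * ∏ i, (a i).elim 1 (fun c => 1 / (z (Fin.natAdd (B + 2) i) - (∑ i', (c.1 i' : ℝ) * z (Fin.castAdd k i') + (c.2 : ℝ))))) s₁.domain ∧ (∃ c₀ : ℝ, 0 < c₀ ∧ ∀ z ∈ s₁.domain, c₀ ≤ |MvPolynomial.aeval (fun i => z (Fin.castAdd k i))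 p|) ∧ (∀ j, (∑ i, (L j).1 i * v i) ≠ 0 → e j ≠ 0 → ∀ z ∈ s₁.domain, ∑ i, ((L j).1 i : ℝ) * z (Fin.castAdd k i) + ((L j).2 : ℝ) ≠ 0) ∧ (∀ j j', (∑ i, (L j).1 i * v i) ≠ 0 → (∑ i, (L j').1 i * v i) ≠ 0 → e j ≠ 0 → e j' ≠ 0 → (∑ i, (L j').1 i * v i) • L j ≠ (∑ i, (L j).1 i * v i) • L j' → ∃ C : ℝ, ∀ z ∈ s₁.domain, |∑ i, ((L j').1 i : ℝ) * z (Fin.castAdd k i) + ((L j').2 : ℝ)| ≤ C * |(((∑ i, (L j).1 i * v i) : ℚ) : ℝ) * (∑ i, ((L j').1 i : ℝ) * z (Fin.castAdd k i) + ((L j').2 : ℝ)) - (((∑ i, (L j').1 i * v i) : ℚ) : ℝ) * (∑ i, ((L j).1 i : ℝ) * z (Fin.castAdd k i) + ((L j).2 : ℝ))|) ∧ w = KZ.of s₁}, x - c ∈ KZ.relations) : ∃ c ∈ AddSubgroup.closure (GG (B + 1) 1 k), x - c ∈ KZ.relations := by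
  obtain ⟨c, hc, hxc⟩ := hfan
  suffices hpiece : ∀ w ∈ {w : KZ.FormalRep | ∃ (m₁ : ℕ) (M₁ : Fin m₁ → (Fin (B + 2) → ℚ) × ℚ)
      (s₁ : KZ.IntegralRep (B + 2 + k)) (v : Fin (B + 2) → ℚ), v (Fin.last (B + 1)) ≠ 0 ∧
      Bornology.IsBounded s₁.domain ∧
      s₁.domain = {z | (∀ j, 0 < ∑ i, ((M₁ j).1 i : ℝ) * z (Fin.castAdd k i) + ((M₁ j).2 : ℝ)) ∧
        ∀ i, Sum.elim (fun j => z (Fin.natAdd (B + 2) j)) (fun c => ∑ i', (c.1 i' : ℝ) *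
          z (Fin.castAdd k i') + (c.2 : ℝ)) (lo i) < z (Fin.natAdd (B + 2) i) ∧
          z (Fin.natAdd (B + 2) i) < Sum.elim (fun j => z (Fin.natAdd (B + 2) j))
          (fun c => ∑ i', (c.1 i' : ℝ) * z (Fin.castAdd k i') + (c.2 : ℝ)) (hi i)} ∧
      EqOn s₁.integrand (fun z => MvPolynomial.aeval (fun i => z (Fin.castAdd k i)) p /
        (∏ j, (∑ i, ((L j).1 i : ℝ) * z (Fin.castAdd k i) + ((L j).2 : ℝ)) ^ e j) *
        ∏ i, (a i).elim 1 (fun c => 1 / (z (Fin.natAdd (B + 2) i) -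
          (∑ i', (c.1 i' : ℝ) * z (Fin.castAdd k i') + (c.2 : ℝ))))) s₁.domain ∧
      (∃ c₀ : ℝ, 0 < c₀ ∧ ∀ z ∈ s₁.domain, c₀ ≤ |MvPolynomial.aeval (fun i => z (Fin.castAdd k i)) p|) ∧
      (∀ j, (∑ i, (L j).1 i * v i) ≠ 0 → e j ≠ 0 → ∀ z ∈ s₁.domain,
        ∑ i, ((L j).1 i : ℝ) * z (Fin.castAdd k i) + ((L j).2 : ℝ) ≠ 0) ∧
      (∀ j j', (∑ i, (L j).1 i * v i) ≠ 0 → (∑ i, (L j').1 i * v i) ≠ 0 → e j ≠ 0 → e j' ≠ 0 →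
        (∑ i, (L j').1 i * v i) • L j ≠ (∑ i, (L j).1 i * v i) • L j' →
        ∃ C : ℝ, ∀ z ∈ s₁.domain, |∑ i, ((L j').1 i : ℝ) * z (Fin.castAdd k i) + ((L j').2 : ℝ)| ≤
          C * |(((∑ i, (L j).1 i * v i) : ℚ) : ℝ) * (∑ i, ((L j').1 i : ℝ) * z (Fin.castAdd k i) +
            ((L j').2 : ℝ)) - (((∑ i, (L j').1 i * v i) : ℚ) : ℝ) *
            (∑ i, ((L j).1 i : ℝ) * z (Fin.castAdd k i) + ((L j).2 : ℝ))|) ∧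
      w = KZ.of s₁}, ∃ c' ∈ AddSubgroup.closure (GG (B + 1) 1 k), w - c' ∈ KZ.relations by
    obtain ⟨c', hc', hcc⟩ := SepTwoZero.closure_transfer' hpiece c hc
    refine ⟨c', hc', ?_⟩
    have := add_mem hxc hcc
    rwa [sub_add_sub_cancel] at this
  rintro w ⟨m₁, M₁, s₁, v, hv, hbd₁, hdom₁, hint₁, hnum, hpole, hrat, rfl⟩
  obtain ⟨hA', hA⟩ := dirAinv_mul_inv (n := B + 1) v hv
  refine separateHigh_direction GG hGG B k m m₁ s₁ M₁ L e p a lo hi hbd₁ hdom₁ hint₁ (dirAinv v)⁻¹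
    (dirAinv v) hA hA' (fun j hα he z hz => ?_) (fun j j' hα hα' he he' hne => ?_) hnum
  · rw [vecMul_dirAinv_last] at hα
    exact hpole j hα he z hz
  · rw [vecMul_dirAinv_last] at hα hne
    rw [vecMul_dirAinv_last] at hα' hne
    rw [vecMul_dirAinv_last, vecMul_dirAinv_last]
    exact hrat j j' hα hα' he he' hne

end Summit.KontsevichZagierPeriods.ArrangementNormalForm.JanusBands
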